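import Summits.ABC.StewartYu.PadicCW77EpsShapeFiveHalves
import HarnessLib

/-!
# Rung A1.M1⁺(3) by name: `EpsShapeBoundThree` (`log c ≤ κ_ε · rad(abc)^{3+ε}`) — UNCONDITIONAL

`Summits/ABC/ABC/Theorems/EpsShapeBoundThreeHolds.lean` — cell `abc-stewartyu` (planner g6 WANTED 12:11Z,
filed by p3-g3).  The rung `rad^{5/2+ε}` is the landed theorem `Summit.ABC.StewartYu.epsShapeBoundFiveHalves_holds`
(p1-g3's sharp WP-M + the principal-core machine, `Summits/ABC/StewartYu/PadicCW77EpsShapeFiveHalves.lean`);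
monotonicity of the `ε`-shape in the exponent (`Literature.Barriers.ABC.epsShapeBoundThree_of_fiveHalves`)
gives the rung `rad^{3+ε}` as a BY-NAME tree theorem, so that the route `PadicPrincipalCoreRadThree` (all items
proved) can be ledger-closed against its target.  [folklore] assembly.
-/

set_option linter.dupNamespace false

namespace Summit.ABC.ABC.Theorems

/-- **Rung A1.M1⁺(3): `EpsShapeBoundThree` holds** — for every `ε > 0` there are `κ, c₀` with
`log c ≤ κ · rad(abc)^{3+ε}` for all `abc`-triples with `c ≥ c₀` (from the landed rung `rad^{5/2+ε}`).
[folklore] -/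
theorem epsShapeBoundThree_holds : Literature.Barriers.ABC.EpsShapeBoundThree :=
  Literature.Barriers.ABC.epsShapeBoundThree_of_fiveHalves Summit.ABC.StewartYu.epsShapeBoundFiveHalves_holds

end Summit.ABC.ABC.Theorems
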